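import Summits.FinalStateConjecture.FinalStateConjecture.Theorems.PhotonSphereChannelsKerrDevDefs
import Summits.FinalStateConjecture.FinalStateConjecture.Theorems.SeamedChartsExhaust.Negative.KerrSchildTimeFunction
import Literature.Geometry.Lorentzian.SchwarzschildKerrSchildKoszul
import Literature.Geometry.Lorentzian.SchwarzschildKillingAlgebraProofs
import Literature.Geometry.Lorentzian.KerrRpBulk
import HarnessLib

/-!
# Route PhotonSphereChannels · crux `ChannelsResolveTameDevelopmentsR` (K2R-T2, stmt-FinalStateConjecture-17430) —
# the SCHWARZSCHILD END, III: the horizon `{r = 2M}` of the Kerr–Schild patch is SILENT (non-expanding,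
# shear-free) and uniformly RED-SHIFTED (`κ = 1/4M`) for every clock of the form `x⁰ + F(r)`

Horizon clauses of the hull interface (`TameHullDefs`: `EndDatum.IsSilentHorizon`, `EndDatum.IsRedShifted`,
`KerrDevDefs`: `EndDatum.IsSilent`) for an end datum `E` of the horizon-penetrating Schwarzschild patch
`Kerr.spacetime M 0 r₁` whose future event horizon is the Schwarzschild horizon (`hhor : E.horizon = {r = 2M}`,
file II) and whose clock is `x⁰ + F(r)` (`hclock`), with generator field the STATIONARY KILLING FIELD
`L = ∂_{t*}` (constant components `(1, 0, 0, 0)` in the Kerr–Schild chart):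

* `Schw.two_mul_bilin_leviCivita_e0` — `2 g(∇_X ∂_{t*}, Z) = (2M/r²)(ν(Z) ℓ(X) − ν(X) ℓ(Z))` on the whole patch,
  from the Christoffel symbols of the first kind of `g_{M,0}` (`Schwarzschild.koszulForm_eq_kForm`) and the
  chart formula for the Levi-Civita connection on constant fields (`OpensChart.leviCivita_const_apply`);
* `Schw.leviCivita_e0_e0_of_radius_eq` — **surface gravity**: `∇_{∂_{t*}} ∂_{t*} = (1/4M) ∂_{t*}` on `{r = 2M}`
  (Wald 1984, (12.5.2) with `κ = 1/4M`);
* `Schw.bilin_leviCivita_e0_eq_zero_of_radius_eq` — **the horizon is non-expanding and shear-free**: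
  `g(∇_v ∂_{t*}, w) = 0` for `v, w ⊥ ∂_{t*}` on `{r = 2M}` (there `g(∂_{t*}, v) = ν(v)`);
* `Schw.isSilentHorizon_of_horizon_eq`, `Schw.isRedShifted_of_horizon_eq`, `Schw.isSilent_of_horizon_eq` — the
  clauses themselves (`∂_{t*}` is a smooth section, null and future-directed on `{r = 2M}`, `d(x⁰ + F(r))(∂_{t*}) = 1`,
  and its integral curves keep `r`), hence `E.IsSilent` once `E` is two-sided non-radiating (file II).

Everything is proved; `[Kerr.Facts]` as in files I–II, and the Levi-Civita clauses are stated, as in the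
interface, under `[𝓢.metric.HasLeviCivita]`. No definitions.
References: R. M. Wald, *General Relativity* (1984), §12.5, (12.5.2)–(12.5.4) [Wald1984]; M. Dafermos,
I. Rodnianski, arXiv:0811.0354, §3.3.2 Prop. 3.3.1 and §7.1 [DafermosRodnianski2008]; B. O'Neill,
*Semi-Riemannian geometry* (1983), Ch. 3, Prop. 3.13 [ONeill1983]; R. P. Kerr, A. Schild (1965), §2 [KerrSchild1965].
-/

noncomputable section
set_option maxSynthPendingDepth 3 -- nested operator types `E4 →L E4 →L E4 →L ℝ` (as in the tree files)
set_option linter.dupNamespace false -- `Summit.FinalStateConjecture.FinalStateConjecture.…` is the tree's layout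

open TopologicalSpace Manifold Filter Topology Set Function Bundle
open scoped ContDiff Topology ENNReal Manifold NNReal InnerProductSpace

namespace Summit.FinalStateConjecture.FinalStateConjecture.Theorems.TameHull.Schw

open Literature.Geometry.Lorentzian LorentzianMetric Schwarzschild
open Summit.FinalStateConjecture.FinalStateConjecture.Theorems.SeamedChartsExhaust.Negative

/-! ### Kerr–Schild algebra of `∂_{t*}` -/

section Algebra

variable {M : ℝ} {x : E4}

-- `sdot y (E4.basisVector 0) = 0` is `Schwarzschild.sdot_basisVector_zero` (SchwarzschildKillingAlgebraProofs).

/-- `ℓ(∂_{t*}) = 1`. [cite: arXiv07060622, (34)] -/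
theorem ell_basisVector_zero (x : E4) : ell x (E4.basisVector 0) = 1 := by
  simp [ell, sdot_basisVector_zero]

/-- `ν(∂_{t*}) = 0`. [cite: arXiv07060622, (34)] -/
theorem nu_basisVector_zero (x : E4) : nu x (E4.basisVector 0) = 0 := by
  simp [nu, sdot_basisVector_zero]

/-- `P(X, ∂_{t*}) = 0`. [folklore] -/
theorem proj_basisVector_zero_right (x X : E4) : proj x X (E4.basisVector 0) = 0 := by
  simp [proj, sdot_basisVector_zero]

/-- The Koszul bracket with middle slot `∂_{t*}`: `Q(∂_{t*}; X, Z) = ν(Z) ℓ(X) − ν(X) ℓ(Z)` (static metric: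
`2 g(∇_X ∂_{t*}, Z) = ∂_X g(∂_{t*}, Z) − ∂_Z g(∂_{t*}, X)`). [cite: ONeill1983, Ch. 3, Prop. 3.13] -/
theorem kCore_basisVector_zero (x X Z : E4) :
    kCore x (E4.basisVector 0) X Z = nu x Z * ell x X - nu x X * ell x Z := by
  rw [kCore, proj_basisVector_zero_right, ell_basisVector_zero, nu_basisVector_zero]
  ring

/-- `g_{M,0}(∂_{t*}, w) = −(1 − 2M/r) w⁰ + (2M/r) ν(w)` off the time axis. [cite: arXiv07060622, (32)–(34)] -/
theorem bilin_basisVector_zero_left (M : ℝ) (hx : E4.spatialNorm x ≠ 0) (w : E4) :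
    Kerr.bilin M 0 x (E4.basisVector 0) w =
      -(1 - 2 * M / E4.spatialNorm x) * w 0 + 2 * M / E4.spatialNorm x * nu x w := by
  have h0 : E4.spatial (E4.basisVector 0) = 0 := by
    ext i
    simp
  have h00 : (E4.basisVector 0 : E4) 0 = 1 := by simp
  rw [Kerr.bilin_zero_spin_apply M hx, h0, h00, nu, sdot, inner_zero_left, inner_zero_right, zero_div, add_zero]
  ring

/-- **On the horizon `∂_{t*}` pairs to the radial component**: `g_{M,0}(∂_{t*}, w) = ν(w)` at `r = 2M > 0`.
[cite: Wald1984, §12.5] -/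
theorem bilin_basisVector_zero_left_of_radius_eq (hM : 0 < M) (hx : E4.spatialNorm x = 2 * M) (w : E4) :
    Kerr.bilin M 0 x (E4.basisVector 0) w = nu x w := by
  rw [bilin_basisVector_zero_left M (by rw [hx]; positivity) w, hx]
  have h2 : 2 * M / (2 * M) = 1 := div_self (by positivity)
  rw [h2]
  ring

/-- `∂_{t*}` is NULL on the horizon: `g_{M,0}(∂_{t*}, ∂_{t*}) = −1 + 2M/r = 0` at `r = 2M`. [cite: Wald1984, §12.5] -/
theorem bilin_basisVector_zero_self_of_radius_eq (hM : 0 < M) (hx : E4.spatialNorm x = 2 * M) :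
    Kerr.bilin M 0 x (E4.basisVector 0) (E4.basisVector 0) = 0 := by
  rw [bilin_basisVector_zero_left_of_radius_eq hM hx, nu_basisVector_zero]

end Algebra

/-! ### The Levi-Civita derivative of the stationary field (smooth Kerr metric on the patch) -/

section Connection

-- `[Kerr.Facts]`: the instance hypothesis of `Kerr.smoothMetric` / `Kerr.spacetime` (all three fields are
-- theorems of the tree); `[(Kerr.smoothMetric M 0 r₁).HasLeviCivita]` as in the interface clauses.
variable [Kerr.Facts] {M r₁ : ℝ} [(Kerr.smoothMetric M 0 r₁).HasLeviCivita]

/-- **`2 g(∇_X ∂_{t*}, Z) = (2M/r²) (ν(Z) ℓ(X) − ν(X) ℓ(Z))` on the whole patch**, for the Levi-Civita connection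
of the smooth Kerr metric `g_{M,0}` on `{r > r₁}` (by `rfl` the metric of `Kerr.spacetime M 0 r₁`): on the constant
field `∂_{t*}` of the chart the connection is the Christoffel map of the components
(`OpensChart.leviCivita_const_apply`), whose Koszul form is `Schwarzschild.kForm` (`koszulForm_eq_kForm`).
[cite: ONeill1983, Ch. 3, Prop. 3.13] -/
theorem two_mul_bilin_leviCivita_e0 (x : Kerr.region (0 : ℝ) r₁) (X Z : E4) :
    2 * Kerr.bilin M 0 x.1 ((Kerr.smoothMetric M 0 r₁).toPseudoRiemannianMetric.leviCivita
        (fun _ : Kerr.region (0 : ℝ) r₁ ↦ (E4.basisVector 0 : E4)) x X) Z =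
      2 * M / E4.spatialNorm x.1 ^ 2 * (nu x.1 Z * ell x.1 X - nu x.1 X * ell x.1 Z) := by
  set g := (Kerr.smoothMetric M 0 r₁).toPseudoRiemannianMetric with hg
  have hG : ∀ y : Kerr.region (0 : ℝ) r₁, g.val y = Kerr.bilin M 0 y := fun _ ↦ rfl
  have hx0 : 0 < Kerr.radius 0 x.1 := Kerr.radius_pos_of_mem_region x.2
  have hxs : E4.spatial x.1 ≠ 0 := by
    rw [Kerr.radius_zero_left, E4.spatialNorm] at hx0
    exact norm_pos_iff.mp hx0
  have h1 : g.leviCivita (fun _ : Kerr.region (0 : ℝ) r₁ ↦ (E4.basisVector 0 : E4)) x X =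
      OpensChart.christoffel g (Kerr.bilin M 0) x (E4.basisVector 0) X :=
    OpensChart.leviCivita_const_apply hG x (Kerr.differentiableAt_bilin M 0 x) _ _
  have h2 := OpensChart.two_mul_val_christoffel (g := g) (G := Kerr.bilin M 0) x (E4.basisVector 0) X Z
  rw [hG x, koszulForm_eq_kForm M hxs, kForm, kCore_basisVector_zero] at h2
  rw [h1]
  exact h2

/-- **Surface gravity of the Schwarzschild horizon in the `t*`-normalisation**: on `{r = 2M}`,
`∇_{∂_{t*}} ∂_{t*} = (1/4M) ∂_{t*}` (pair both sides with an arbitrary `w`: `(M/r²) ν(w)` against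
`(1/4M) g(∂_{t*}, w) = (1/4M) ν(w)`, and `g_{M,0}` is nondegenerate). Wald 1984, (12.5.2), `κ = 1/4M`.
[cite: Wald1984, §12.5, (12.5.2)–(12.5.4)] -/
theorem leviCivita_e0_e0_of_radius_eq (hM' : 0 < M) (x : Kerr.region (0 : ℝ) r₁) (hx : Kerr.radius 0 x.1 = 2 * M) :
    (Kerr.smoothMetric M 0 r₁).toPseudoRiemannianMetric.leviCivita
        (fun _ : Kerr.region (0 : ℝ) r₁ ↦ (E4.basisVector 0 : E4)) x (E4.basisVector 0) =
      (1 / (4 * M)) • (E4.basisVector 0 : E4) := by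
  have hx0 : 0 < Kerr.radius 0 x.1 := Kerr.radius_pos_of_mem_region x.2
  have hxn : E4.spatialNorm x.1 = 2 * M := by rwa [Kerr.radius_zero_left] at hx
  set u : E4 := (Kerr.smoothMetric M 0 r₁).toPseudoRiemannianMetric.leviCivita
    (fun _ : Kerr.region (0 : ℝ) r₁ ↦ (E4.basisVector 0 : E4)) x (E4.basisVector 0) with hu
  have hM0 : M ≠ 0 := hM'.ne'
  have key : ∀ w : E4, Kerr.bilin M 0 x.1 u w = 1 / (4 * M) * nu x.1 w := fun w ↦ by
    have h2 := two_mul_bilin_leviCivita_e0 (M := M) (r₁ := r₁) x (E4.basisVector 0) w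
    rw [ell_basisVector_zero, nu_basisVector_zero, hxn] at h2
    field_simp at h2 ⊢
    linear_combination h2
  rw [← sub_eq_zero]
  refine Kerr.bilin_nondegenerate M 0 hx0 (u - (1 / (4 * M)) • (E4.basisVector 0 : E4)) fun w ↦ ?_
  rw [map_sub, map_smul, FunLike.coe_sub, FunLike.coe_smul, Pi.sub_apply,
    Pi.smul_apply, key w, bilin_basisVector_zero_left_of_radius_eq hM' hxn, smul_eq_mul]
  ring

/-- **The Schwarzschild horizon is non-expanding and shear-free**: on `{r = 2M}`, for `v, w ⊥ ∂_{t*}`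
(equivalently `ν(v) = ν(w) = 0`), `g(∇_v ∂_{t*}, w) = 0` — the null second fundamental form of the horizon along
its generator `∂_{t*}` vanishes. Wald 1984, §12.5. [cite: Wald1984, §12.5, (12.5.2)–(12.5.4)] -/
theorem bilin_leviCivita_e0_eq_zero_of_radius_eq (hM' : 0 < M) (x : Kerr.region (0 : ℝ) r₁)
    (hx : Kerr.radius 0 x.1 = 2 * M) (v w : E4) (hv : Kerr.bilin M 0 x.1 (E4.basisVector 0) v = 0)
    (hw : Kerr.bilin M 0 x.1 (E4.basisVector 0) w = 0) :
    Kerr.bilin M 0 x.1 ((Kerr.smoothMetric M 0 r₁).toPseudoRiemannianMetric.leviCivita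
        (fun _ : Kerr.region (0 : ℝ) r₁ ↦ (E4.basisVector 0 : E4)) x v) w = 0 := by
  have hxn : E4.spatialNorm x.1 = 2 * M := by rwa [Kerr.radius_zero_left] at hx
  rw [bilin_basisVector_zero_left_of_radius_eq hM' hxn] at hv hw
  have h2 := two_mul_bilin_leviCivita_e0 (M := M) (r₁ := r₁) x v w
  rw [hv, hw] at h2
  linarith

end Connection

/-! ### The stationary field as a horizon generator: regularity, clock rate, invariance -/

section Patch

variable [Kerr.Facts] {M r₁ : ℝ} {hM : 0 ≤ M}

/-- The constant field `∂_{t*}` is a `C^∞` section of the tangent bundle of the patch. [folklore] -/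
theorem contMDiffOn_e0_section :
    ContMDiffOn (𝓡 4) (𝓡 4).tangent ∞
      (fun x : (Kerr.spacetime M 0 r₁ hM).carrier ↦
        (TotalSpace.mk' E4 x (E4.basisVector 0 : E4) : TangentBundle (𝓡 4) (Kerr.spacetime M 0 r₁ hM).carrier))
      univ := by
  intro x _
  refine ContMDiffAt.contMDiffWithinAt ?_
  rw [ModelWithCorners.tangent]
  exact (OpensChart.contMDiffAt_section_iff (U := Kerr.region (0 : ℝ) r₁) x
    (fun _ ↦ (E4.basisVector 0 : E4))).mpr contMDiffAt_const

/-- `∂_{t*}` is null and future-directed on the horizon `{r = 2M}` (`g(∂_{t*}, ∂_{t*}) = 0`, `g(V, ∂_{t*}) = −1`).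
[cite: Wald1984, §12.5] -/
theorem isNull_isFutureDirected_e0_of_radius_eq (hM' : 0 < M) (x : (Kerr.spacetime M 0 r₁ hM).carrier)
    (hx : Kerr.radius 0 x.1 = 2 * M) :
    (Kerr.spacetime M 0 r₁ hM).metric.IsNull (x := x) (E4.basisVector 0 : E4) ∧
      (Kerr.spacetime M 0 r₁ hM).timeOrientation.IsFutureDirected (x := x) (E4.basisVector 0 : E4) := by
  have hxn : E4.spatialNorm x.1 = 2 * M := by rwa [Kerr.radius_zero_left] at hx
  have h0 : Kerr.bilin M 0 x.1 (E4.basisVector 0) (E4.basisVector 0) = 0 :=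
    bilin_basisVector_zero_self_of_radius_eq hM' hxn
  have hV : Kerr.bilin M 0 x.1 (Kerr.timeVector M 0 x.1) (E4.basisVector 0) < 0 := by
    rw [Kerr.bilin_timeVector (Kerr.radius_pos_of_mem_region x.2)]
    simp
  exact ⟨⟨h0, Schw.basisVector_zero_ne_zero⟩, ⟨h0.le, Schw.basisVector_zero_ne_zero⟩, hV⟩

omit [Kerr.Facts] in
/-- The coordinate function `x⁰ + F(r(x))` is smooth off the time axis for smooth `F`. [folklore] -/
theorem contDiffAt_radialClock' {F : ℝ → ℝ} (hF : ContDiff ℝ ∞ F) {z : E4} (hz : 0 < Kerr.radius 0 z) :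
    ContDiffAt ℝ ∞ (fun z : E4 ↦ z 0 + F (Kerr.radius 0 z)) z :=
  ((EuclideanSpace.proj (0 : Fin 4)).contDiff.contDiffAt).add (hF.contDiffAt.comp z (Kerr.contDiffAt_radius hz))

omit [Kerr.Facts] in
/-- The radial clock `x⁰ + F(r)` has unit rate along `∂_{t*}`: `d(x⁰ + F(r))(∂_{t*}) = 1` (along the line
`t ↦ z + t ∂_{t*}` the clock reads `z⁰ + t + F(r(z))`, `∂_{t*} r = 0`). [folklore] -/
theorem fderiv_radialClock_basisVector_zero {F : ℝ → ℝ} (hF : ContDiff ℝ ∞ F) {z : E4}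
    (hz : 0 < Kerr.radius 0 z) :
    fderiv ℝ (fun z : E4 ↦ z 0 + F (Kerr.radius 0 z)) z (E4.basisVector 0) = 1 := by
  have hd : DifferentiableAt ℝ (fun z : E4 ↦ z 0 + F (Kerr.radius 0 z)) z :=
    (contDiffAt_radialClock' hF hz).differentiableAt (by simp)
  -- along the line `t ↦ z + t ∂_{t*}`
  have hline : HasDerivAt (fun t : ℝ ↦ z + t • (E4.basisVector 0 : E4)) (E4.basisVector 0) 0 := by
    simpa using ((hasDerivAt_id (0 : ℝ)).smul_const (E4.basisVector 0 : E4)).const_add z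
  have hcomp : HasDerivAt (fun t : ℝ ↦ (z + t • (E4.basisVector 0 : E4)) 0 +
      F (Kerr.radius 0 (z + t • (E4.basisVector 0 : E4))))
      (fderiv ℝ (fun z : E4 ↦ z 0 + F (Kerr.radius 0 z)) z (E4.basisVector 0)) 0 := by
    have hd' : HasFDerivAt (fun z : E4 ↦ z 0 + F (Kerr.radius 0 z))
        (fderiv ℝ (fun z : E4 ↦ z 0 + F (Kerr.radius 0 z)) z) (z + (0 : ℝ) • (E4.basisVector 0 : E4)) := by
      rw [zero_smul, add_zero]; exact hd.hasFDerivAt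
    exact hd'.comp_hasDerivAt (0 : ℝ) hline
  have heq : (fun t : ℝ ↦ (z + t • (E4.basisVector 0 : E4)) 0 + F (Kerr.radius 0 (z + t • (E4.basisVector 0 : E4)))) =
      fun t ↦ t + (z 0 + F (Kerr.radius 0 z)) := by
    funext t
    rw [Kerr.radius_add_time_smul_basisVector]
    simp
    ring
  rw [heq] at hcomp
  exact hcomp.unique ((hasDerivAt_id (0 : ℝ)).add_const _)

/-- **The clock `x⁰ + F(r)` of the end is normalised on `∂_{t*}`**: `mvfderiv clock p (∂_{t*}) = 1`. [folklore] -/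
theorem mvfderiv_clock_e0 (E : EndDatum (Kerr.spacetime M 0 r₁ hM)) {F : ℝ → ℝ} (hF : ContDiff ℝ ∞ F)
    (hclock : ∀ x, E.clock x = x.1 0 + F (Kerr.radius 0 x.1)) (p : (Kerr.spacetime M 0 r₁ hM).carrier) :
    mvfderiv (𝓡 4) E.clock p (E4.basisVector 0 : E4) = 1 := by
  have hp : 0 < Kerr.radius 0 p.1 := Kerr.radius_pos_of_mem_region p.2
  have hdiff : DifferentiableAt ℝ (fun z : E4 ↦ z 0 + F (Kerr.radius 0 z)) p.1 :=
    (contDiffAt_radialClock' hF hp).differentiableAt (by simp)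
  have h := OpensChart.mvfderiv_eq (U := Kerr.region (0 : ℝ) r₁) p E.clock
    (fun z : E4 ↦ z 0 + F (Kerr.radius 0 z)) hclock hdiff (E4.basisVector 0)
  rw [fderiv_radialClock_basisVector_zero hF hp] at h
  exact h

/-- `∂_{t*} r = 0`, read as the manifold derivative of the radius function of the patch. [folklore] -/
theorem mvfderiv_radius_e0 (p : (Kerr.spacetime M 0 r₁ hM).carrier) :
    mvfderiv (𝓡 4) (fun x : (Kerr.spacetime M 0 r₁ hM).carrier ↦ Kerr.radius 0 x.1) p (E4.basisVector 0 : E4) = 0 := by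
  have hp : 0 < Kerr.radius 0 p.1 := Kerr.radius_pos_of_mem_region p.2
  have h := OpensChart.mvfderiv_eq (U := Kerr.region (0 : ℝ) r₁) p
    (fun x : (Kerr.spacetime M 0 r₁ hM).carrier ↦ Kerr.radius 0 x.1) (Kerr.radius 0) (fun _ ↦ rfl)
    ((Kerr.contDiffAt_radius hp (n := 1)).differentiableAt one_ne_zero) (E4.basisVector 0)
  rw [Kerr.fderiv_radius_basisVector_zero 0 hp] at h
  exact h

-- `TangentSpace 𝓘(ℝ, ℝ) s` is definitionally `ℝ`; reading the manifold derivative of the real function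
-- `r ∘ γ` as an ordinary derivative moves across this identification (same pattern as
-- `RedShiftedHorizon.monotoneOn_comp_of_isMIntegralCurveOn`).
set_option backward.isDefEq.respectTransparency false in
/-- **The integral curves of `∂_{t*}` keep the radius**: along an integral curve of the constant field on
`[a, b]`, `r ∘ γ` has derivative `∂_{t*} r = 0`, hence is constant; in particular the level sets `{r = c}` —
the horizon `{r = 2M}` among them — are forward invariant. [folklore] -/
theorem radius_eq_of_isMIntegralCurveOn {γ : ℝ → (Kerr.spacetime M 0 r₁ hM).carrier} {a b : ℝ} (hab : a ≤ b)
    (hγ : IsMIntegralCurveOn (I := 𝓡 4) γ (fun _ : (Kerr.spacetime M 0 r₁ hM).carrier ↦ (E4.basisVector 0 : E4)) (Icc a b)) :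
    Kerr.radius 0 (γ b).1 = Kerr.radius 0 (γ a).1 := by
  set f : (Kerr.spacetime M 0 r₁ hM).carrier → ℝ := fun x ↦ Kerr.radius 0 x.1 with hf
  have hfd : ∀ p : (Kerr.spacetime M 0 r₁ hM).carrier, MDifferentiableAt (𝓡 4) 𝓘(ℝ, ℝ) f p := fun p ↦
    (OpensChart.mdifferentiableAt_iff (U := Kerr.region (0 : ℝ) r₁) p f (Kerr.radius 0) (fun _ ↦ rfl)).mpr
      ((Kerr.contDiffAt_radius (Kerr.radius_pos_of_mem_region p.2) (n := 1)).differentiableAt one_ne_zero)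
  have hderiv : ∀ s ∈ Icc a b, HasDerivWithinAt (f ∘ γ) 0 (Icc a b) s := by
    intro s hs
    rw [hasDerivWithinAt_iff_hasFDerivWithinAt, ← hasMFDerivWithinAt_iff_hasFDerivWithinAt]
    apply ((hfd (γ s)).hasMFDerivAt.comp_hasMFDerivWithinAt s (hγ s hs)).congr_mfderiv
    rw [ContinuousLinearMap.ext_iff]
    intro r
    have h1 : mfderiv (𝓡 4) 𝓘(ℝ, ℝ) f (γ s) (E4.basisVector 0 : E4) = (0 : ℝ) :=
      mvfderiv_radius_e0 (hM := hM) (γ s)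
    simp only [ContinuousLinearMap.comp_apply, ContinuousLinearMap.smulRight_apply, map_smul]
    erw [h1]
    simp
  have hcont : ContinuousOn (f ∘ γ) (Icc a b) := fun s hs ↦ (hderiv s hs).continuousWithinAt
  have hmono := monotoneOn_of_hasDerivWithinAt_nonneg (convex_Icc a b) hcont
    (fun s hs ↦ (hderiv s (interior_subset hs)).mono interior_subset) fun _ _ ↦ le_rfl
  have hanti := antitoneOn_of_hasDerivWithinAt_nonpos (convex_Icc a b) hcont
    (fun s hs ↦ (hderiv s (interior_subset hs)).mono interior_subset) fun _ _ ↦ le_rfl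
  exact le_antisymm (hanti (left_mem_Icc.mpr hab) (right_mem_Icc.mpr hab) hab)
    (hmono (left_mem_Icc.mpr hab) (right_mem_Icc.mpr hab) hab)

/-! ### The horizon clauses of the interface -/

variable (E : EndDatum (Kerr.spacetime M 0 r₁ hM))

/-- **The Schwarzschild end has a SILENT horizon** (`EndDatum.IsSilentHorizon`): with `L = ∂_{t*}` — a smooth
section, null and future-directed on `E.horizon = {r = 2M}`, normalised by the clock `x⁰ + F(r)`, whose integral
curves stay on the horizon — the horizon is non-expanding and shear-free
(`bilin_leviCivita_e0_eq_zero_of_radius_eq`). Wald 1984, §12.5. [cite: Wald1984, §12.5, (12.5.2)–(12.5.4)] -/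
theorem isSilentHorizon_of_horizon_eq (hM' : 0 < M) (hhor : E.horizon = {x | Kerr.radius 0 x.1 = 2 * M})
    {F : ℝ → ℝ} (hF : ContDiff ℝ ∞ F) (hclock : ∀ x, E.clock x = x.1 0 + F (Kerr.radius 0 x.1)) :
    E.IsSilentHorizon := by
  intro inst
  haveI : (Kerr.smoothMetric M 0 r₁).HasLeviCivita := inst
  refine ⟨fun _ ↦ (E4.basisVector 0 : E4), ⟨univ, isOpen_univ, subset_univ _, contMDiffOn_e0_section⟩,
    fun p hp ↦ ?_, fun γ a b hab hγ ha ↦ ?_⟩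
  · rw [hhor] at hp
    obtain ⟨hN, hF'⟩ := isNull_isFutureDirected_e0_of_radius_eq (hM := hM) hM' p hp
    exact ⟨hN, hF', mvfderiv_clock_e0 E hF hclock p, fun v w hv hw ↦
      bilin_leviCivita_e0_eq_zero_of_radius_eq (M := M) (r₁ := r₁) hM' p hp v w hv hw⟩
  · rw [hhor] at ha ⊢
    show Kerr.radius 0 (γ b).1 = 2 * M
    rw [radius_eq_of_isMIntegralCurveOn (hM := hM) hab hγ]
    exact ha

/-- **The Schwarzschild end is uniformly RED-SHIFTED with `κ₀ = 1/4M`** (`EndDatum.IsRedShifted`: surface gravity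
`≥ 1/4M` on `E.horizon` w.r.t. the clock `x⁰ + F(r)`), generator `∂_{t*}`, `∇_{∂_{t*}} ∂_{t*} = (1/4M) ∂_{t*}`.
Dafermos–Rodnianski arXiv:0811.0354, §7.1 (hypothesis of Thm. 7.1); Wald 1984, (12.5.2).
[cite: DafermosRodnianski2008, §7.1 Thm. 7.1 and §3.3.2 Prop. 3.3.1] -/
theorem isRedShifted_of_horizon_eq (hM' : 0 < M) (hhor : E.horizon = {x | Kerr.radius 0 x.1 = 2 * M})
    {F : ℝ → ℝ} (hF : ContDiff ℝ ∞ F) (hclock : ∀ x, E.clock x = x.1 0 + F (Kerr.radius 0 x.1)) :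
    E.IsRedShifted (1 / (4 * M)) := by
  intro inst
  haveI : (Kerr.smoothMetric M 0 r₁).HasLeviCivita := inst
  refine ⟨fun _ ↦ (E4.basisVector 0 : E4), fun _ ↦ 1 / (4 * M),
    ⟨univ, isOpen_univ, subset_univ _, contMDiffOn_e0_section⟩, fun p hp ↦ ?_, fun γ a b hab hγ ha ↦ ?_⟩
  · rw [hhor] at hp
    obtain ⟨hN, hF'⟩ := isNull_isFutureDirected_e0_of_radius_eq (hM := hM) hM' p hp
    exact ⟨hN, hF', mvfderiv_clock_e0 E hF hclock p,
      leviCivita_e0_e0_of_radius_eq (M := M) (r₁ := r₁) hM' p hp, le_rfl⟩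
  · rw [hhor] at ha ⊢
    show Kerr.radius 0 (γ b).1 = 2 * M
    rw [radius_eq_of_isMIntegralCurveOn (hM := hM) hab hγ]
    exact ha

/-- **The Schwarzschild end is SILENT** (`EndDatum.IsSilent`: two-sided non-radiating ∧ silent horizon ∧
red-shifted, here with `κ₀ = 1/4M`), given that it is non-radiating (file II: the far deviation vanishes).
[cite: Wald1984, §12.5, (12.5.2)–(12.5.4)] -/
theorem isSilent_of_horizon_eq (hM' : 0 < M) (hhor : E.horizon = {x | Kerr.radius 0 x.1 = 2 * M})
    {F : ℝ → ℝ} (hF : ContDiff ℝ ∞ F) (hclock : ∀ x, E.clock x = x.1 0 + F (Kerr.radius 0 x.1))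
    (hnr : E.IsNonRadiating) : E.IsSilent :=
  ⟨hnr, isSilentHorizon_of_horizon_eq E hM' hhor hF hclock,
    Or.inl ⟨1 / (4 * M), by positivity, isRedShifted_of_horizon_eq E hM' hhor hF hclock⟩⟩

/-- The red-shifted branch of `IsSilent` is the one realised, with the explicit surface gravity `1/4M`. [folklore] -/
theorem exists_isRedShifted_of_horizon_eq (hM' : 0 < M) (hhor : E.horizon = {x | Kerr.radius 0 x.1 = 2 * M})
    {F : ℝ → ℝ} (hF : ContDiff ℝ ∞ F) (hclock : ∀ x, E.clock x = x.1 0 + F (Kerr.radius 0 x.1)) :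
    ∃ κ₀ : ℝ, 0 < κ₀ ∧ E.IsRedShifted κ₀ :=
  ⟨1 / (4 * M), by positivity, isRedShifted_of_horizon_eq E hM' hhor hF hclock⟩

end Patch

/-- Registered summary (stmt-FinalStateConjecture-17430, route seat 1): **the Schwarzschild horizon `{r = 2M}` of an end
datum of the Kerr–Schild patch with radial clock `x⁰ + F(r)` is SILENT and RED-SHIFTED with `κ₀ = 1/4M`** (generator
`∂_{t*}`), hence the end is silent once non-radiating. [cite: Wald1984, §12.5, (12.5.2)–(12.5.4)] -/
theorem schwarzschild_horizon_silent_redShifted : ∀ [Kerr.Facts] {M r₁ : ℝ} {hM : 0 ≤ M} (E : EndDatum (Kerr.spacetime M 0 r₁ hM)), 0 < M → E.horizon = {x | Kerr.radius 0 x.1 = 2 * M} → ∀ {F : ℝ → ℝ}, ContDiff ℝ ∞ F → (∀ x, E.clock x = x.1 0 + F (Kerr.radius 0 x.1)) → E.IsSilentHorizon ∧ E.IsRedShifted (1 / (4 * M)) ∧ (E.IsNonRadiating → E.IsSilent) :=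
  fun E hM' hhor _ hF hclock ↦ ⟨isSilentHorizon_of_horizon_eq E hM' hhor hF hclock,
    isRedShifted_of_horizon_eq E hM' hhor hF hclock, isSilent_of_horizon_eq E hM' hhor hF hclock⟩

end Summit.FinalStateConjecture.FinalStateConjecture.Theorems.TameHull.Schw

end
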